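import Summits.ResolutionOfSingularities.ResolutionOfSingularities.Theorems.FrobeniusLadderFInjectiveMacaulayficationFullLastCentreDefs
import Summits.ResolutionOfSingularities.ResolutionOfSingularities.Theorems.FrobeniusLadderFInjectiveMacaulayficationKLocCellKitMod
import Summits.ResolutionOfSingularities.ResolutionOfSingularities.Theorems.FrobeniusLadderFInjectiveMacaulayficationCIPolyKit
import HarnessLib

/-!
# KIT TOOLS FOR TYPED-DOOR INSTANCES (`FullLastCentreDefs` ✓p727906 × the `KLocCellKit` term-list arithmetic): supports of term lists, the chart map `σ_L` on term lists,
# and kernel-checkable normal forms for the two polynomial identities of a stage (`IsChart`, `IsResidual`)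
# (crux `FInjectiveMacaulayfication` stmt-ResolutionOfSingularities-15315, chain w45a; res-L1-w45a-plan-1 R25.41 (iii) / res-L1-w45a-lead-1 g16 «TAKE IT» l.39274; generic half of the bed-c
# kernel negative `…FullLastCentreBedCInstance`; seat res-L1-w45a-stub-1 g17)

[OURS · L1 W4.5a] Support file (`--supports stmt-ResolutionOfSingularities-15315 --as helper`); small computable definitions (`tauFun`, `nk`, `chartNF`, `discExpr`) + soundness lemmas in the currency of
✓ `KLocCellKit` (`evalL`/`evalK`, `withKey`, `normL`, `mulK`, `addNFK`, `shiftK`) and ✓ `CIPolyKit.coeff_evalL`; no instance, no named fact; NOT a statement of any manuscript; nothing of the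
crux is proved. AI-written (AI review is weaker than expert review).
* §1 supports: `coe_mem_of_mem_support_evalL` (support ⊆ listed exponents), `mem_support_evalL_of_not_dvd` (a listed exponent with coefficient `≢ 0 mod p` is in the support),
  `coeff_zero_evalL`, `forall_support_of_list`; §2 the chart map: `tauFun`/`tau_symm` (computable `tau`), `chartMap_monomial`, `chartMap_evalL`, `X_pow_mul_evalL`, `monomial_mul_evalL`,
  `evalK_const`; §3 normal forms: `nk`/`evalK_nk` (kit-normalised keyed copy), `chartNF`/★`chart_identity_of_nf` (`σ_L(value B) = y_L^j·value B′` from «all coefficients of the normal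
  form are `≡ 0 mod p`», one `decide`), `discExpr`/★`evalK_discExpr` (the cubic discriminant of three keyed lists).
[folklore]
-/

-- single-problem summit: the doubled namespace component is forced
set_option linter.dupNamespace false

noncomputable section

open MvPolynomial Finsupp

namespace Summit.ResolutionOfSingularities.ResolutionOfSingularities.Theorems.FInjectiveMacaulayfication.LastCentreKit

open Summit.ResolutionOfSingularities.ResolutionOfSingularities.Theorems.FInjectiveMacaulayfication LastCentreDefs KLocCellKit

variable {K : Type} [Field K]

/-! ## §1 Supports of term lists -/

variable {n : ℕ}

/-- A monomial in the support of the value of a term list has its exponent vector in the list. [plumbing] -/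
theorem coe_mem_of_mem_support_evalL (Lst : List (ℤ × (Fin n → ℕ))) (e : Fin n →₀ ℕ) (he : e ∈ (evalL K Lst).support) :
    (⇑e) ∈ Lst.map Prod.snd := by
  classical
  by_contra hnot
  have h := CIPolyKit.coeff_evalL (K := K) (⇑e) Lst
  rw [Finsupp.equivFunOnFinite_symm_coe] at h
  have hnil : (Lst.filter fun t : ℤ × (Fin n → ℕ) => t.2 = ⇑e) = [] := by
    rw [List.filter_eq_nil_iff]
    intro t ht htrue
    exact hnot (List.mem_map.mpr ⟨t, ht, of_decide_eq_true htrue⟩)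
  rw [hnil, List.map_nil, List.sum_nil, Int.cast_zero] at h
  exact (MvPolynomial.mem_support_iff.mp he) (by rw [evalL]; exact h)

/-- A listed exponent whose coefficient sum is not divisible by the characteristic is in the support. [plumbing] -/
theorem mem_support_evalL_of_not_dvd (p : ℕ) [CharP K p] (Lst : List (ℤ × (Fin n → ℕ))) (v : Fin n → ℕ)
    (h : ¬ ((p : ℤ) ∣ ((Lst.filter fun t : ℤ × (Fin n → ℕ) => t.2 = v).map fun t : ℤ × (Fin n → ℕ) => t.1).sum)) :
    Finsupp.equivFunOnFinite.symm v ∈ (evalL K Lst).support := by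
  rw [MvPolynomial.mem_support_iff, evalL, CIPolyKit.coeff_evalL]
  intro hz
  exact h ((CharP.intCast_eq_zero_iff K p _).mp hz)

/-- The constant coefficient of the value of a term list. [plumbing] -/
theorem coeff_zero_evalL (Lst : List (ℤ × (Fin n → ℕ))) :
    coeff 0 (evalL K Lst) = ((((Lst.filter fun t : ℤ × (Fin n → ℕ) => t.2 = 0).map fun t : ℤ × (Fin n → ℕ) => t.1).sum : ℤ) : K) := by
  have h := CIPolyKit.coeff_evalL (K := K) (0 : Fin n → ℕ) Lst
  rw [show (Finsupp.equivFunOnFinite.symm (0 : Fin n → ℕ) : Fin n →₀ ℕ) = 0 from by ext; simp] at h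
  rw [evalL]
  exact h

/-- Every support element satisfies a property that holds on the listed exponents. [plumbing] -/
theorem forall_support_of_list (Lst : List (ℤ × (Fin n → ℕ))) (P : (Fin n → ℕ) → Prop) (hP : ∀ t ∈ Lst, P t.2) :
    ∀ e ∈ (evalL K Lst).support, P ⇑e := by
  intro e he
  obtain ⟨t, ht, hte⟩ := List.mem_map.mp (coe_mem_of_mem_support_evalL Lst e he)
  exact hte ▸ hP t ht

/-! ## §2 The chart map on term lists -/

/-- The computable twin of `tau` on exponent functions. [plumbing] -/
def tauFun (Nor : Finset Letter) (L : Letter) (v : Letter → ℕ) : Letter → ℕ :=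
  fun m => v m + if m = L then ∑ i ∈ Nor.erase L, v i else 0

/-- `tau` agrees with `tauFun`. [plumbing] -/
theorem tau_symm (Nor : Finset Letter) (L : Letter) (v : Letter → ℕ) :
    tau Nor L (Finsupp.equivFunOnFinite.symm v) = Finsupp.equivFunOnFinite.symm (tauFun Nor L v) := by
  ext m
  simp only [tau, norDeg, AddMonoidHom.coe_mk, ZeroHom.coe_mk, Finsupp.coe_add, Pi.add_apply, Finsupp.coe_equivFunOnFinite_symm, tauFun,
    Finsupp.single_apply]
  by_cases h : m = L
  · subst h; simp
  · simp [h, Ne.symm h]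

/-- The chart map on a monomial. [plumbing] -/
theorem chartMap_monomial (Nor : Finset Letter) (L : Letter) (e : Expo) (c : K) :
    chartMap Nor L (monomial e c) = monomial (tau Nor L e) c := by
  rw [chartMap, AddMonoidAlgebra.mapDomainRingHom_apply, ← single_eq_monomial, ← single_eq_monomial]
  exact AddMonoidAlgebra.mapDomain_single

/-- The chart map on the value of a term list = the value of the list with `tauFun` applied to the exponents. [plumbing] -/
theorem chartMap_evalL (Nor : Finset Letter) (L : Letter) (Lst : List (ℤ × (Letter → ℕ))) :
    chartMap Nor L (evalL K Lst) = evalL K (Lst.map fun t : ℤ × (Letter → ℕ) => (t.1, tauFun Nor L t.2)) := by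
  induction Lst with
  | nil => simp [evalL]
  | cons t Lst ih =>
    simp only [evalL, List.map_cons, List.sum_cons, map_add] at ih ⊢
    rw [ih, chartMap_monomial, tau_symm]

/-- `y_L^j · value` as the value of a keyed shifted list. [plumbing] -/
theorem X_pow_mul_evalL (L : Fin n) (j : ℕ) (Lst : List (ℤ × (Fin n → ℕ))) :
    (X L : MvPolynomial (Fin n) K) ^ j * evalL K Lst = evalK K (shiftK ((1 : ℤ), key (Pi.single L j : Fin n → ℕ), (Pi.single L j : Fin n → ℕ)) (withKey Lst)) := by
  rw [evalK_shiftK, evalK_withKey, Int.cast_one, X_pow_eq_monomial]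
  congr 2
  ext m
  simp

/-- `y^a · value` as the value of a keyed shifted list. [plumbing] -/
theorem monomial_mul_evalL (a : Fin n → ℕ) (Lst : List (ℤ × (Fin n → ℕ))) :
    monomial (Finsupp.equivFunOnFinite.symm a) (1 : K) * evalL K Lst = evalK K (shiftK ((1 : ℤ), key a, a) (withKey Lst)) := by
  rw [evalK_shiftK, evalK_withKey, Int.cast_one]

/-- A constant keyed term list `[(c, 0, 0)]` has value `C c`. [plumbing] -/
theorem evalK_const (c : ℤ) : evalK K ([(c, 0, (0 : Fin n → ℕ))] : List (ℤ × ℕ × (Fin n → ℕ))) = C (c : K) := by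
  rw [evalK_cons, evalK_nil, add_zero, show (Finsupp.equivFunOnFinite.symm (0 : Fin n → ℕ) : Fin n →₀ ℕ) = 0 from by ext; simp, monomial_zero']

/-! ## §3 Kernel-checkable normal forms for `IsChart` and `IsResidual` -/

/-- Kit-normalised keyed copy of a term list (sorted by key, collected) — the form the merges of `addNFK`/`mulK` require. [plumbing] -/
def nk (B : List (ℤ × (Fin 4 → ℕ))) : List (ℤ × ℕ × (Fin 4 → ℕ)) := withKey (normL B)

/-- `evalK (nk B) = evalL B`. [plumbing] -/
theorem evalK_nk (B : List (ℤ × (Fin 4 → ℕ))) : evalK K (nk B) = evalL K B := by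
  rw [nk, evalK_withKey, evalL_normL]

/-- The keyed normal form of `σ_L(value B) − y_L^j·value B′` for the centre with normal letters `Nor` and chart letter `L`. [certificate scheme] -/
def chartNF (Nor : Finset Letter) (L : Letter) (B B' : List (ℤ × (Fin 4 → ℕ))) (j : ℕ) : List (ℤ × ℕ × (Fin 4 → ℕ)) :=
  addNFK (nk (B.map fun t : ℤ × (Letter → ℕ) => (t.1, tauFun Nor L t.2)))
    (shiftK ((-1 : ℤ), key (Pi.single L j : Fin 4 → ℕ), (Pi.single L j : Fin 4 → ℕ)) (nk B'))

/-- ★ SOUNDNESS of `chartNF`: if all its coefficients vanish mod `p = char K` then `σ_L(value B) = y_L^j · value B′` — the `IsChart` identities from ONE `decide`. [plumbing] -/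
theorem chart_identity_of_nf (p : ℕ) [CharP K p] (Nor : Finset Letter) (L : Letter) (B B' : List (ℤ × (Fin 4 → ℕ))) (j : ℕ)
    (h : ∀ t ∈ chartNF Nor L B B' j, (p : ℤ) ∣ t.1) :
    chartMap Nor L (evalL K B) = (X L : YPoly K) ^ j * evalL K B' := by
  have hz := evalK_eq_zero_of_dvd K p (chartNF Nor L B B' j) h
  rw [chartNF, evalK_addNFK, evalK_nk, evalK_shiftK, evalK_nk, Int.cast_neg, Int.cast_one, map_neg, neg_mul] at hz
  rw [chartMap_evalL, X_pow_mul_evalL, evalK_shiftK, evalK_withKey, Int.cast_one]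
  exact (sub_eq_zero.mp (by rw [sub_eq_add_neg]; exact hz))

/-- The cubic discriminant `b₂²b₁² − 4b₁³ − 4b₂³b₀ − 27b₀² + 18b₂b₁b₀` as a keyed expression in three keyed lists. [certificate scheme] -/
def discExpr (A2 A1 A0 : List (ℤ × ℕ × (Fin 4 → ℕ))) : List (ℤ × ℕ × (Fin 4 → ℕ)) :=
  addNFK (mulK (mulK A2 A2) (mulK A1 A1))
    (addNFK (shiftK ((-4 : ℤ), 0, (0 : Fin 4 → ℕ)) (mulK A1 (mulK A1 A1)))
      (addNFK (shiftK ((-4 : ℤ), 0, (0 : Fin 4 → ℕ)) (mulK (mulK A2 (mulK A2 A2)) A0))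
        (addNFK (shiftK ((-27 : ℤ), 0, (0 : Fin 4 → ℕ)) (mulK A0 A0))
          (shiftK ((18 : ℤ), 0, (0 : Fin 4 → ℕ)) (mulK A2 (mulK A1 A0))))))

/-- ★ SOUNDNESS of `discExpr`: its value is `disc` of the values. [plumbing] -/
theorem evalK_discExpr (A2 A1 A0 : List (ℤ × ℕ × (Fin 4 → ℕ))) : evalK K (discExpr A2 A1 A0) = disc (evalK K A2) (evalK K A1) (evalK K A0) := by
  have h0 : (Finsupp.equivFunOnFinite.symm (0 : Fin 4 → ℕ) : Fin 4 →₀ ℕ) = 0 := by ext; simp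
  simp only [discExpr, disc, evalK_addNFK, evalK_mulK, evalK_shiftK, h0, monomial_zero', Int.cast_neg, Int.cast_ofNat, map_neg, map_ofNat]
  ring

end Summit.ResolutionOfSingularities.ResolutionOfSingularities.Theorems.FInjectiveMacaulayfication.LastCentreKit

end
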